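import Mathlib
import Summits.NavierStokesRegularity.NavierStokesRegularity.Theorems.TaoLadderRungTwoBreakOneShiftWindowPairStepEnd
import Summits.NavierStokesRegularity.NavierStokesRegularity.Theorems.TaoLadderRungTwoBreakOneShiftWindowGridCD
import HarnessLib

/-!
# The one-shift window system, LVII: THE PRODUCT CHAIN WITH END-OF-STEP SLOPES — `GridD.prodOKE s`
# (`(endMatA_s[h_s] ± Ẑ₂) ⊗ V_s ⊆ V_{s+1}`, part LV's point-time C¹ form in place of the all-`τ` box of part XXXIX's
# `prodOK`), `mem_Vent_succE`, and the centred-grid glue rebuilt on it: `GridCD.mem_start_of_gridCE`,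
# `GridCD.exists_flowSlope_of_gridC_uptoE` (parts XLIX verbatim with `prodOKE` on the regular steps; the FINAL step
# keeps `prodOK S`, whose all-`τ` box is exactly what a flight time anywhere in the final step needs)
# (cell harvest/h2-tao-ladder, seat p2; rung1/KERNEL-CHEAP-REPLAY-SPEC.md §2 (g)/(h), §10; support for K1(1) =
# `NoSurvivingDSSOne`, stmt-NavierStokesRegularity-20205)

MODEL lattice ODEs only (Tao 2016 §4 normal form on Tao's shift set `S`); nothing here is a statement about the
Navier–Stokes equations; no item is closed; no instance is evaluated here (each Boolean is meant for its own
`native_decide` file). Generic in `ι`, `κ`.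
-/

-- the sub-problem namespace repeats the summit name by design (D-0017)
set_option linter.dupNamespace false

namespace Summit.NavierStokesRegularity.NavierStokesRegularity.Theorems

namespace DSSOneShift

open Set Finset Metric Filter Topology TopologicalSpace
open Literature.Analysis.ODE
open Summit.NavierStokesRegularity.NavierStokesRegularity.Theorems.TaylorModelCert
open Summit.NavierStokesRegularity.NavierStokesRegularity.Theorems.TaylorModelReadout
open Summit.NavierStokesRegularity.NavierStokesRegularity.Theorems.CertificateGlueOn

namespace GridD

variable (g : GridD)

/-- The materialised end-of-step C¹ table of step `s` at its own step length (part LV `endMatA [h_s, h_s]`). [cite: Moore1979, §8.1 eq. (8.13); NedialkovJacksonPryce2001, §3] -/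
def endA (s : ℕ) : Array IntervalD := (g.step s).toRoughStepD.centre.endMatA (IntervalD.ofDyad (g.h s))

/-- End-of-step slope box `A_s^E = [EA.lo − Ẑ₂, EA.hi + Ẑ₂]` read from a materialised table `EA`. [cite: KapelaZgliczynski2009, §4 Thm. 9; cell vocabulary, harvest/h2-tao-ladder rung1/KERNEL-CHEAP-REPLAY-SPEC.md §2 (g)] -/
def AentE (EA : Array IntervalD) (s i l : ℕ) : IntervalD :=
  ⟨(IntervalD.aget EA (l * g.n + i)).lo.sub ((g.step s).mget (g.step s).Zh2 i l),
    (IntervalD.aget EA (l * g.n + i)).hi.add ((g.step s).mget (g.step s).Zh2 i l)⟩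

/-- Entry `(i,l)` of the rounded interval product `A_s^E ⊗ V_s`. [cite: Neumaier1991, §3.1 (interval matrix product)] -/
def prodEntE (EA : Array IntervalD) (s i l : ℕ) : IntervalD :=
  IntervalD.rangeSumR g.prec (fun j => IntervalD.mulR g.prec (g.AentE EA s i j) (g.Vent s j l)) g.n

/-- **The end-of-step product test of step `s`**: `A_s^E ⊗ V_s ⊆ V_{s+1}` entrywise (the table `endA s` is computed
once). [cite: Neumaier1991, §3.1 Proposition 3.1.2; cell vocabulary, harvest/h2-tao-ladder rung1/KERNEL-CHEAP-REPLAY-SPEC.md §2 (g)/(h)] -/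
def prodOKE (s : ℕ) : Bool :=
  let EA := g.endA s
  (List.range g.n).all fun i => (List.range g.n).all fun l => IntervalD.subset (g.prodEntE EA s i l) (g.Vent (s + 1) i l)

/-- What `prodOKE = true` says. [folklore] -/
theorem of_prodOKE {s : ℕ} (h : g.prodOKE s = true) : ∀ i < g.n, ∀ l < g.n,
    IntervalD.subset (g.prodEntE (g.endA s) s i l) (g.Vent (s + 1) i l) = true := by
  unfold prodOKE at h
  simp only [List.all_eq_true, List.mem_range] at h
  exact fun i hi l hl => h i hi l hl

variable {ι : Type*} [Fintype ι] [DecidableEq ι] {κ : Type*} [Fintype κ]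

omit [Fintype ι] [DecidableEq ι] in
/-- The real bounds of `A_s^E` read through `e` are those of the pair step's point-time box. [folklore] -/
theorem AentE_toReal (e : ι ≃ Fin g.n) (hn : ∀ s, (g.step s).n = g.n) (s : ℕ) (i l : ι) :
    (g.AentE (g.endA s) s (e i) (e l)).lo.toReal =
      ((g.step s).toRoughStepD.centre.endMatI (IntervalD.ofDyad (g.step s).hD) (g.es e hn s i) (g.es e hn s l)).lo.toReal -
        (g.step s).cZh (g.es e hn s) i l ∧
    (g.AentE (g.endA s) s (e i) (e l)).hi.toReal =
      ((g.step s).toRoughStepD.centre.endMatI (IntervalD.ofDyad (g.step s).hD) (g.es e hn s i) (g.es e hn s l)).hi.toReal +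
        (g.step s).cZh (g.es e hn s) i l := by
  have hi : (e i : ℕ) < (g.step s).toRoughStepD.centre.n := by
    show (e i : ℕ) < (g.step s).n; rw [hn]; exact (e i).isLt
  have hl : (e l : ℕ) < (g.step s).toRoughStepD.centre.n := by
    show (e l : ℕ) < (g.step s).n; rw [hn]; exact (e l).isLt
  have hnn : (g.step s).toRoughStepD.centre.n = g.n := by show (g.step s).n = g.n; exact hn s
  have hget : IntervalD.aget (g.endA s) ((e l : ℕ) * g.n + (e i : ℕ)) =
      (g.step s).toRoughStepD.centre.endMatI (IntervalD.ofDyad (g.h s)) (e i) (e l) := by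
    have h := (g.step s).toRoughStepD.centre.aget_endMatA (IntervalD.ofDyad (g.h s)) hi hl
    rw [hnn] at h
    exact h
  simp [AentE, hget, GridD.h, PairStepD.cZh, es_val, Dyad.toReal_sub, Dyad.toReal_add]

omit [DecidableEq ι] in
/-- A step of the end-of-step product chain: real matrices in `A_s^E` and `V_s` multiply into `V_{s+1}`. [cite: Neumaier1991, §3.1 Proposition 3.1.2 (6)–(7)] -/
theorem mem_Vent_succE (e : ι ≃ Fin g.n) (hn : ∀ s, (g.step s).n = g.n) {s : ℕ} (hp : g.prodOKE s = true)
    {M P : Matrix ι ι ℝ}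
    (hM : ∀ i j, (g.AentE (g.endA s) s (e i) (e j)).lo.toReal ≤ M i j ∧ M i j ≤ (g.AentE (g.endA s) s (e i) (e j)).hi.toReal)
    (hP : ∀ i l, IntervalD.mem (P i l) (g.Vent s (e i) (e l))) :
    ∀ i l, IntervalD.mem ((M * P) i l) (g.Vent (s + 1) (e i) (e l)) := by
  have _ := hn
  intro i l
  refine IntervalD.mem_of_subset (g.of_prodOKE hp (e i) (e i).isLt (e l) (e l).isLt) ?_
  rw [Matrix.mul_apply]
  unfold prodEntE
  refine mem_sum_equiv e g.prec fun k hk => ?_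
  have h1 := hM i (e.symm ⟨k, hk⟩)
  have h2 := hP (e.symm ⟨k, hk⟩) l
  simp only [Equiv.apply_symm_apply] at h1 h2
  exact IntervalD.mem_mulR g.prec ⟨h1.1, h1.2⟩ h2

end GridD

namespace GridCD

variable (g : GridCD)

section Sound

variable {ι : Type*} [Fintype ι] [DecidableEq ι] {κ : Type*} [Fintype κ]

/-- **THE CENTRED C⁰ CHAIN WITH END-OF-STEP SLOPES** (part XLIX `mem_start_of_gridC` with `prodOKE`). Reference run `S_c` from `c ∈ P_0` and any run `S_u` from `a ∈ W_0` of the same rough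
realisation on `[0, T]`, `t_S ≤ T`, all tests passed: at every grid time `S_c(t_s) ∈ P_s`, `S_u(t_s) ∈ W_s`, and
`S_u(t_s) − S_c(t_s) = U (a − c)` for a real `U ∈ V_s`. [cite: Tao2016AveragedNS, §5.3; Moore1979, §8.1 eq. (8.13); WalawskaWilczak2016, §2.2 Lemma 2; cell vocabulary, harvest/h2-tao-ladder rung1/KERNEL-CHEAP-REPLAY-SPEC.md §2 (f)–(h)] -/
theorem mem_start_of_gridCE (e : ι ≃ Fin g.n) (hn : ∀ s, (g.step s).n = g.n)
    {Tc : ℕ → κ → BTerm ι} {Tf : ℝ → κ → BTerm ι} {rows : ι → List κ}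
    (hRDc : ∀ s ≤ g.S, IsRTEncl (g.es e hn s) (Tc s) (Tc s) rows (g.step s).RD)
    (hRD : ∀ s ≤ g.S, ∀ r ∈ Ico 0 (g.h s).toReal, IsRTEncl (g.es e hn s) (Tc s) (Tf (g.t s + r)) rows (g.step s).RD)
    (hstep : ∀ s ≤ g.S, g.stepOK s = true) (hinit : g.initOK = true) (hprod : ∀ s < g.S, g.prodOKE s = true)
    (hpwf : ∀ s ≤ g.S, g.pwfOK s = true) (hpsub : ∀ s ≤ g.S, g.psubOK s = true)
    (hplink : ∀ s < g.S, g.plinkOK s = true) (hwlink : ∀ s < g.S, g.wlinkOK s = true)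
    {T : ℝ} (hT : g.t g.S ≤ T)
    {c : ι → ℝ} (hc : c ∈ boxSet (boxOf e (g.P 0))) {Sc : ℝ → ι → ℝ} (hSc0 : Sc 0 = c)
    (hSc : ∀ t ∈ Icc 0 T, HasDerivWithinAt Sc (termField (Tf t) (Sc t)) (Icc 0 T) t)
    {a : ι → ℝ} (ha : a ∈ boxSet (boxOf e (g.step 0).W)) {Su : ℝ → ι → ℝ} (hSu0 : Su 0 = a)
    (hSu : ∀ t ∈ Icc 0 T, HasDerivWithinAt Su (termField (Tf t) (Su t)) (Icc 0 T) t) :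
    ∀ s ≤ g.S, Sc (g.t s) ∈ boxSet (boxOf e (g.P s)) ∧ Su (g.t s) ∈ boxSet (boxOf e (g.step s).W) ∧
      ∃ U : Matrix ι ι ℝ, (∀ i l, IntervalD.mem (U i l) (g.Vent s (e i) (e l))) ∧
        Su (g.t s) - Sc (g.t s) = U.mulVec (a - c) := by
  classical
  have hchk : ∀ s ≤ g.S, (g.step s).check = true := fun s hs => by
    have := hstep s hs
    simp only [GridD.stepOK, Bool.and_eq_true, decide_eq_true_eq] at this
    exact this.1
  have hh : ∀ s ≤ g.S, 0 ≤ (g.h s).toReal := fun s hs => (g.h_nonneg_and_wfW (hstep s hs)).1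
  have hwfW : ∀ s ≤ g.S, ∀ k < g.n, wfD (IntervalD.aget (g.step s).W k) = true := fun s hs k hk =>
    (g.h_nonneg_and_wfW (hstep s hs)).2 k (by rw [hn]; exact hk)
  have hwfP : ∀ s ≤ g.S, ∀ k < g.n, wfD (IntervalD.aget (g.P s) k) = true := fun s hs => of_all_range (hpwf s hs)
  -- the difference `a − c` in `dW0`
  have hdiff : ∀ l, IntervalD.mem (a l - c l) (g.dW0 (e l)) := fun l =>
    IntervalD.mem_sub (mem_of_mem_toNI (hwfW 0 (Nat.zero_le _) _ (e l).isLt) ((mem_boxSet_iff.1 ha) l))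
      (mem_of_mem_toNI (hwfP 0 (Nat.zero_le _) _ (e l).isLt) ((mem_boxSet_iff.1 hc) l))
  intro s
  induction s with
  | zero =>
    intro _
    refine ⟨by simpa [hSc0] using hc, by simpa [hSu0] using ha, 1, g.mem_Vent_zero e hinit, ?_⟩
    simp [hSu0, hSc0]
  | succ s ih =>
    intro hs
    have hs' : s < g.S := Nat.lt_of_succ_le hs
    obtain ⟨hPc, hWu, U, hU, hrep⟩ := ih hs'.le
    -- the reference run starts the step in `W_s` too
    have hPW : boxSet (boxOf e (g.P s)) ⊆ boxSet (boxOf e (g.step s).W) := fun x hx => by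
      rw [mem_boxSet_iff] at hx ⊢
      intro i
      exact mem_toNI (IntervalD.mem_of_subset (of_all_range (hpsub s hs'.le) _ (e i).isLt)
        (mem_of_mem_toNI (hwfP s hs'.le _ (e i).isLt) (hx i)))
    have hWc := hPW hPc
    -- the re-clocked runs on step `s`
    have hts0 : 0 ≤ g.t s := g.t_nonneg fun k hk => hh k (by omega)
    have htsT : g.t s + (g.h s).toReal ≤ T := by
      rw [← GridD.t_succ]
      exact (g.t_mono hs fun k hk => hh k hk.le).trans hT
    have hrunC : ∀ r ∈ Icc 0 (g.h s).toReal,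
        HasDerivWithinAt (fun r => Sc (g.t s + r)) (termField (Tf (g.t s + r)) (Sc (g.t s + r))) (Icc 0 (g.h s).toReal) r :=
      fun r hr => hasDerivWithinAt_shift (S := Sc) (S' := fun t => termField (Tf t) (Sc t)) hSc hts0 htsT hr
    have hrunU : ∀ r ∈ Icc 0 (g.h s).toReal,
        HasDerivWithinAt (fun r => Su (g.t s + r)) (termField (Tf (g.t s + r)) (Su (g.t s + r))) (Icc 0 (g.h s).toReal) r :=
      fun r hr => hasDerivWithinAt_shift (S := Su) (S' := fun t => termField (Tf t) (Su t)) hSu hts0 htsT hr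
    have hchk' : (g.step s).toRoughStepD.check = true := by
      have : (g.step s).toRoughStepD.check = true ∧ (g.step s).checkPair = true := by
        simpa [PairStepD.check, Bool.and_eq_true] using hchk s hs'.le
      exact this.1
    -- (i) the reference run ends in `P_{s+1}`
    have hPc' : Sc (g.t s) ∈ boxSet (boxOf (g.es e hn s) (g.P s)) := by rwa [GridD.boxOf_es]
    have hendC : ∀ i, IntervalD.mem (Sc (g.t (s + 1)) i) (IntervalD.aget (g.P (s + 1)) (e i)) := by
      intro i
      have h1 := (g.step s).toRoughStepD.end_mem_on (g.es e hn s) (hRDc s hs'.le) (hRD s hs'.le) hchk'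
        (X := g.P s) (fun k hk => hwfP s hs'.le k (by rw [← hn s]; exact hk))
        (fun k hk => of_all_range (hpsub s hs'.le) k (by rw [← hn s]; exact hk)) hPc'
        (Su := fun r => Sc (g.t s + r)) (by simp) hrunC (tD := g.h s) ⟨hh s hs'.le, le_rfl⟩ i
      simp only [GridD.es_val] at h1
      rw [GridD.t_succ]
      exact IntervalD.mem_of_subset (of_all_range (hplink s hs') _ (e i).isLt) h1
    have hPc1 : Sc (g.t (s + 1)) ∈ boxSet (boxOf e (g.P (s + 1))) :=
      mem_boxSet_iff.2 fun i => mem_toNI (hendC i)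
    -- (ii) the pair slope of (S_u, S_c) on step `s`
    have hau : Su (g.t s) ∈ boxSet (boxOf (g.es e hn s) (g.step s).W) := by rw [GridD.boxOf_es]; exact hWu
    have hbc : Sc (g.t s) ∈ boxSet (boxOf (g.es e hn s) (g.step s).W) := by rw [GridD.boxOf_es]; exact hWc
    obtain ⟨A, hA, hArep⟩ := (g.step s).sound_end (g.es e hn s) (hRDc s hs'.le) (hRD s hs'.le) (hchk s hs'.le) hau hbc
      (Su := fun r => Su (g.t s + r)) (Sv := fun r => Sc (g.t s + r)) (by simp) (by simp) hrunU hrunC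
    have hA' : ∀ i j, (g.AentE (g.endA s) s (e i) (e j)).lo.toReal ≤ A i j ∧
        A i j ≤ (g.AentE (g.endA s) s (e i) (e j)).hi.toReal := by
      intro i j
      have h1 := hA i j
      have h2 := g.AentE_toReal e hn s i j
      rw [h2.1, h2.2]
      exact h1
    have hU' : ∀ i l, IntervalD.mem ((A * U) i l) (g.Vent (s + 1) (e i) (e l)) := g.mem_Vent_succE e hn (hprod s hs') hA' hU
    have hrep' : Su (g.t (s + 1)) - Sc (g.t (s + 1)) = (A * U).mulVec (a - c) := by
      rw [GridD.t_succ]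
      have h1 : Su (g.t s + (g.h s).toReal) - Sc (g.t s + (g.h s).toReal) = A.mulVec (Su (g.t s) - Sc (g.t s)) :=
        hArep
      rw [h1, hrep, Matrix.mulVec_mulVec]
    -- (iii) the run ends in `W_{s+1}` (centred form)
    have hWu1 : Su (g.t (s + 1)) ∈ boxSet (boxOf e (g.step (s + 1)).W) := by
      rw [mem_boxSet_iff]
      intro i
      refine mem_toNI (IntervalD.mem_of_subset (of_all_range (hwlink s hs') _ (e i).isLt) ?_)
      have hval : Su (g.t (s + 1)) i = Sc (g.t (s + 1)) i + ∑ l, (A * U) i l * (a l - c l) := by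
        have := congrFun hrep' i
        simp only [Pi.sub_apply, Matrix.mulVec, dotProduct] at this
        linarith
      rw [hval]
      unfold affEnt
      refine IntervalD.mem_addR g.prec (hendC i) (mem_sum_equiv e g.prec fun k hk => ?_)
      have h1 := hU' i (e.symm ⟨k, hk⟩)
      have h2 := hdiff (e.symm ⟨k, hk⟩)
      simp only [Equiv.apply_symm_apply] at h1 h2
      exact IntervalD.mem_mulR g.prec h1 h2
    exact ⟨hPc1, hWu1, A * U, hU', hrep'⟩

/-- **THE FLOW SLOPE OF THE CENTRED GRID FOR RUNS ENDING INSIDE THE FINAL STEP, END-OF-STEP SLOPES ON THE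
REGULAR STEPS** (part XLIX `exists_flowSlope_of_gridC_upto` with `prodOKE` for `s < S` and `prodOK S`) (the conclusion of part XLV
`exists_flowSlope_of_grid_upto`, the C⁰ chain by `mem_start_of_gridC` with a reference run from `P_0`).
[cite: Tao2016AveragedNS, §5.3; WalawskaWilczak2016, §2.2 Lemma 2; cell vocabulary, harvest/h2-tao-ladder rung1/KERNEL-CHEAP-REPLAY-SPEC.md §2 (g)/(h), §9] -/
theorem exists_flowSlope_of_gridC_uptoE (e : ι ≃ Fin g.n) (hn : ∀ s, (g.step s).n = g.n)
    {Tc : ℕ → κ → BTerm ι} {Tf : ℝ → κ → BTerm ι} {rows : ι → List κ}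
    (hRDc : ∀ s ≤ g.S, IsRTEncl (g.es e hn s) (Tc s) (Tc s) rows (g.step s).RD)
    (hRD : ∀ s ≤ g.S, ∀ r ∈ Ico 0 (g.h s).toReal, IsRTEncl (g.es e hn s) (Tc s) (Tf (g.t s + r)) rows (g.step s).RD)
    (hstep : ∀ s ≤ g.S, g.stepOK s = true) (hinit : g.initOK = true) (hprod : ∀ s < g.S, g.prodOKE s = true)
    (hprodS : g.prodOK g.S = true)
    (hpwf : ∀ s ≤ g.S, g.pwfOK s = true) (hpsub : ∀ s ≤ g.S, g.psubOK s = true)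
    (hplink : ∀ s < g.S, g.plinkOK s = true) (hwlink : ∀ s < g.S, g.wlinkOK s = true)
    {T : ℝ} (hT : g.t g.S ≤ T) (hTS : T ≤ g.t g.S + (g.h g.S).toReal)
    {c : ι → ℝ} (hc : c ∈ boxSet (boxOf e (g.P 0))) {Sc : ℝ → ι → ℝ} (hSc0 : Sc 0 = c)
    (hSc : ∀ t ∈ Icc 0 T, HasDerivWithinAt Sc (termField (Tf t) (Sc t)) (Icc 0 T) t)
    {a b : ι → ℝ} (ha : a ∈ boxSet (boxOf e (g.step 0).W)) (hb : b ∈ boxSet (boxOf e (g.step 0).W))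
    {Su Sv : ℝ → ι → ℝ} (hSu0 : Su 0 = a) (hSv0 : Sv 0 = b)
    (hSu : ∀ t ∈ Icc 0 T, HasDerivWithinAt Su (termField (Tf t) (Su t)) (Icc 0 T) t)
    (hSv : ∀ t ∈ Icc 0 T, HasDerivWithinAt Sv (termField (Tf t) (Sv t)) (Icc 0 T) t) :
    (∀ τ ∈ Icc (g.t g.S) T, ∃ U : Matrix ι ι ℝ,
      (∀ i l, (g.Vent (g.S + 1) (e i) (e l)).lo.toReal ≤ U i l ∧ U i l ≤ (g.Vent (g.S + 1) (e i) (e l)).hi.toReal) ∧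
      Su τ - Sv τ = U.mulVec (a - b)) ∧
    (∀ τ ∈ Icc (g.t g.S) T, Su τ ∈ boxSet (boxOf e (g.step g.S).Hs) ∧ Sv τ ∈ boxSet (boxOf e (g.step g.S).Hs)) := by
  classical
  have hchk : ∀ s ≤ g.S, (g.step s).check = true := fun s hs => by
    have := hstep s hs
    simp only [GridD.stepOK, Bool.and_eq_true, decide_eq_true_eq] at this
    exact this.1
  have hh : ∀ s ≤ g.S, 0 ≤ (g.h s).toReal := fun s hs => (g.h_nonneg_and_wfW (hstep s hs)).1
  -- start boxes along the grid (centred chain)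
  have hWu : ∀ s ≤ g.S, Su (g.t s) ∈ boxSet (boxOf e (g.step s).W) := fun s hs =>
    (g.mem_start_of_gridCE e hn hRDc hRD hstep hinit hprod hpwf hpsub hplink hwlink hT hc hSc0 hSc
      ha hSu0 hSu s hs).2.1
  have hWv : ∀ s ≤ g.S, Sv (g.t s) ∈ boxSet (boxOf e (g.step s).W) := fun s hs =>
    (g.mem_start_of_gridCE e hn hRDc hRD hstep hinit hprod hpwf hpsub hplink hwlink hT hc hSc0 hSc
      hb hSv0 hSv s hs).2.1
  -- grid times
  have ht0 : ∀ s ≤ g.S, 0 ≤ g.t s := fun s hs => g.t_nonneg fun k hk => hh k (by omega)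
  have htT : ∀ s < g.S, g.t s + (g.h s).toReal ≤ T := fun s hs => by
    rw [← GridD.t_succ]
    exact (g.t_mono (Nat.succ_le_of_lt hs) fun k hk => hh k hk.le).trans hT
  -- the re-clocked runs on a regular step
  have hrunU : ∀ s < g.S, ∀ r ∈ Icc 0 (g.h s).toReal,
      HasDerivWithinAt (fun r => Su (g.t s + r)) (termField (Tf (g.t s + r)) (Su (g.t s + r))) (Icc 0 (g.h s).toReal) r :=
    fun s hs r hr => hasDerivWithinAt_shift (S := Su) (S' := fun t => termField (Tf t) (Su t)) hSu (ht0 s hs.le) (htT s hs) hr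
  have hrunV : ∀ s < g.S, ∀ r ∈ Icc 0 (g.h s).toReal,
      HasDerivWithinAt (fun r => Sv (g.t s + r)) (termField (Tf (g.t s + r)) (Sv (g.t s + r))) (Icc 0 (g.h s).toReal) r :=
    fun s hs r hr => hasDerivWithinAt_shift (S := Sv) (S' := fun t => termField (Tf t) (Sv t)) hSv (ht0 s hs.le) (htT s hs) hr
  -- the re-clocked runs on the final step, up to `τ'`
  have hfinU : ∀ τ' ∈ Icc 0 (T - g.t g.S), ∀ r ∈ Icc 0 τ',
      HasDerivWithinAt (fun r => Su (g.t g.S + r)) (termField (Tf (g.t g.S + r)) (Su (g.t g.S + r))) (Icc 0 τ') r :=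
    fun τ' hτ' r hr => hasDerivWithinAt_shift (S := Su) (S' := fun t => termField (Tf t) (Su t)) hSu (ht0 g.S le_rfl)
      (by linarith [hτ'.2]) hr
  have hfinV : ∀ τ' ∈ Icc 0 (T - g.t g.S), ∀ r ∈ Icc 0 τ',
      HasDerivWithinAt (fun r => Sv (g.t g.S + r)) (termField (Tf (g.t g.S + r)) (Sv (g.t g.S + r))) (Icc 0 τ') r :=
    fun τ' hτ' r hr => hasDerivWithinAt_shift (S := Sv) (S' := fun t => termField (Tf t) (Sv t)) hSv (ht0 g.S le_rfl)
      (by linarith [hτ'.2]) hr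
  have hauS : Su (g.t g.S) ∈ boxSet (boxOf (g.es e hn g.S) (g.step g.S).W) := by rw [GridD.boxOf_es]; exact hWu g.S le_rfl
  have hbvS : Sv (g.t g.S) ∈ boxSet (boxOf (g.es e hn g.S) (g.step g.S).W) := by rw [GridD.boxOf_es]; exact hWv g.S le_rfl
  -- the final step up to `τ − t_S`
  have hfinal : ∀ τ ∈ Icc (g.t g.S) T,
      (∃ U : Matrix ι ι ℝ,
        (∀ i j, ((g.step g.S).toRoughStepD.centre.vv (g.es e hn g.S i) (g.es e hn g.S j)).lo.toReal - (g.step g.S).cZh (g.es e hn g.S) i j ≤ U i j ∧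
          U i j ≤ ((g.step g.S).toRoughStepD.centre.vv (g.es e hn g.S i) (g.es e hn g.S j)).hi.toReal + (g.step g.S).cZh (g.es e hn g.S) i j) ∧
        Su τ - Sv τ = U.mulVec (Su (g.t g.S) - Sv (g.t g.S))) ∧
      (Su τ ∈ boxSet (boxOf e (g.step g.S).Hs) ∧ Sv τ ∈ boxSet (boxOf e (g.step g.S).Hs)) := by
    intro τ hτ
    have hτ' : τ - g.t g.S ∈ Icc 0 (g.h g.S).toReal := ⟨by linarith [hτ.1], by linarith [hτ.2, hTS]⟩
    have hτ'' : τ - g.t g.S ∈ Icc 0 (T - g.t g.S) := ⟨by linarith [hτ.1], by linarith [hτ.2]⟩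
    obtain ⟨⟨U, hU, hrep⟩, hH⟩ := (g.step g.S).sound_upto (g.es e hn g.S) (hRDc g.S le_rfl) (hRD g.S le_rfl)
      (hchk g.S le_rfl) hauS hbvS hτ' (Su := fun r => Su (g.t g.S + r)) (Sv := fun r => Sv (g.t g.S + r))
      (by simp) (by simp) (hfinU _ hτ'') (hfinV _ hτ'')
    have e1 : g.t g.S + (τ - g.t g.S) = τ := by ring
    refine ⟨⟨U, hU, by simpa [e1] using hrep⟩, ?_⟩
    have hH' := hH (τ - g.t g.S) ⟨hτ''.1, le_rfl⟩
    simp only [e1, GridD.boxOf_es] at hH'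
    exact hH'
  refine ⟨fun τ hτ => ?_, fun τ hτ => (hfinal τ hτ).2⟩
  -- real boxes of the step slopes and of the products
  let lo : ℕ → Matrix ι ι ℝ := fun s => Matrix.of fun i j => (g.AentE (g.endA s) s (e i) (e j)).lo.toReal
  let hi : ℕ → Matrix ι ι ℝ := fun s => Matrix.of fun i j => (g.AentE (g.endA s) s (e i) (e j)).hi.toReal
  let loS : Matrix ι ι ℝ := Matrix.of fun i j => (g.Aent g.S (e i) (e j)).lo.toReal
  let hiS : Matrix ι ι ℝ := Matrix.of fun i j => (g.Aent g.S (e i) (e j)).hi.toReal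
  let Ulo : Matrix ι ι ℝ := Matrix.of fun i j => (g.Vent (g.S + 1) (e i) (e j)).lo.toReal
  let Uhi : Matrix ι ι ℝ := Matrix.of fun i j => (g.Vent (g.S + 1) (e i) (e j)).hi.toReal
  have hslope : ∀ s < g.S, ∃ U : Matrix ι ι ℝ,
      (∀ i j, lo s i j ≤ U i j ∧ U i j ≤ hi s i j) ∧
      Su (g.t s + (g.h s).toReal) - Sv (g.t s + (g.h s).toReal) = U.mulVec (Su (g.t s) - Sv (g.t s)) := by
    intro s hs
    have hau : Su (g.t s) ∈ boxSet (boxOf (g.es e hn s) (g.step s).W) := by rw [GridD.boxOf_es]; exact hWu s hs.le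
    have hbv : Sv (g.t s) ∈ boxSet (boxOf (g.es e hn s) (g.step s).W) := by rw [GridD.boxOf_es]; exact hWv s hs.le
    obtain ⟨U, hU, hrep⟩ := (g.step s).sound_end (g.es e hn s) (hRDc s hs.le) (hRD s hs.le) (hchk s hs.le) hau hbv
      (Su := fun r => Su (g.t s + r)) (Sv := fun r => Sv (g.t s + r)) (by simp) (by simp) (hrunU s hs) (hrunV s hs)
    refine ⟨U, fun i j => ?_, hrep⟩
    have h1 := hU i j
    have h2 := g.AentE_toReal e hn s i j
    simp only [lo, hi, Matrix.of_apply]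
    rw [h2.1, h2.2]
    exact h1
  refine exists_gridSlope Su Sv g.t g.t_zero g.S τ lo hi loS hiS Ulo Uhi ?_ ?_ ?_ |>.imp fun U hU => ?_
  · intro s hs
    obtain ⟨U, hU, hrep⟩ := hslope s hs
    exact ⟨U, hU, by rw [GridD.t_succ]; exact hrep⟩
  · obtain ⟨U, hU, hrep⟩ := (hfinal τ hτ).1
    refine ⟨U, fun i j => ?_, hrep⟩
    have h1 := hU i j
    have h2 := g.Aent_toReal e hn g.S i j
    simp only [loS, hiS, Matrix.of_apply]
    rw [h2.1, h2.2]
    exact h1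
  · intro Us UB hUs hUB
    have hP : ∀ k ≤ g.S, ∀ i l, IntervalD.mem ((((List.range k).map Us).reverse.prod) i l) (g.Vent k (e i) (e l)) := by
      intro k hk
      induction k with
      | zero => simpa using g.mem_Vent_zero e hinit
      | succ k ih =>
        have e1 : ((List.range (k + 1)).map Us).reverse.prod = Us k * ((List.range k).map Us).reverse.prod := by
          rw [List.range_succ, List.map_append, List.reverse_append, List.prod_append]; simp
        rw [e1]
        exact g.mem_Vent_succE e hn (hprod k (by omega)) (fun i j => by
          have := hUs k (by omega) i j; simp only [lo, hi, Matrix.of_apply] at this; exact this) (ih (by omega))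
    have hfin := g.mem_Vent_succ e hprodS (M := UB) (fun i j => by
      have := hUB i j; simp only [loS, hiS, Matrix.of_apply] at this; exact this) (hP g.S le_rfl)
    intro i j
    simp only [Ulo, Uhi, Matrix.of_apply]
    exact ⟨(hfin i j).1, (hfin i j).2⟩
  · obtain ⟨hU1, hU2⟩ := hU
    refine ⟨fun i l => ?_, by rw [hU2, hSu0, hSv0]⟩
    have := hU1 i l
    simp only [Ulo, Uhi, Matrix.of_apply] at this
    exact this

end Sound

end GridCD

end DSSOneShift

end Summit.NavierStokesRegularity.NavierStokesRegularity.Theorems
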